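import Summits.ResolutionOfSingularities.ResolutionOfSingularities.Theorems.MarkedTransferCampaignW46TameRegime
import Literature.AlgebraicGeometry.Resolution.RidgeEqualDegree
import Literature.AlgebraicGeometry.Resolution.RidgeIdealAdditive
import Literature.RingTheory.MvPolynomial.NuInvariantBaseChange
import HarnessLib

/-!
# [OURS · L1 W4.6, rung (iv) «large characteristic»] In regime (iv) of the TYPED procedure the RIDGE of the tangent cone
# of every state at every point is a linear subspace, cut out by the linear Hasse–Schmidt coefficients of the initial
# forms; in every characteristic it is generated by additive `p`-forms (Giraud)
# (cell res-hironaka, LADDER-RESOLUTION rung L, D-0089; slot W4.6, seat res-L1-s46-pv-7 gen 3; host route MarkedTransfer,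
# `--supports stmt-ResolutionOfSingularities-16155 --as helper`)

HONEST FRAMING. Nothing here is a statement of H. Hironaka's manuscript (2017-03-23, [Hironaka2017]) and nothing here
asserts that any statement of it holds. OURS corollaries, over the shared typed-procedure module
`MarkedTransferCampaignW46TypedProcedure` (res-L1-type-o1: `CampaignW46.Regime.charGT`, `AmbientDatum`, `IdealExponent`
— typed CANDIDATE carriers used as definitions) and the TREE's cone vocabulary
(`Literature.AlgebraicGeometry.Resolution.initialForms c J μ` = `cl_μ(J)`, the degree-`μ` initial forms of an ideal of
a local ring; `ridge` / `ridgeIdeal`, Giraud's ridge functor and its ideal), of this seat's Literature landings of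
gen 3: `RidgeEqualDegree.lean` (the ridge of a cone defined in one degree; tame ⇒ linear) and `RidgeIdealAdditive.lean`
(Giraud's structure theorem, every characteristic). No premise of the manuscript, no FACT-LIST premise. AI review is
weaker than expert review. No `sorry`, no new definition; axioms standard.

## What this file adds to `TameRegime` (p483854: directrix and `τ` are first-order in regime (iv))

The third tangent-cone invariant, Giraud's RIDGE `Rid(C)` of the cone `C = V(cl_b(J_ξ))` (CJS Rem. 18.29: «replace
the dimension of the directrix by the dimension of the ridge»; Hironaka's `Inv = (n, n − r, q₁, …, q_r)` of the ridge):

* EVERY characteristic (`ridgeIdeal_initialForms_eq_iSup`, `ridgeIdeal_initialForms_eq_span_isAdditive`): the ideal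
  of the ridge of the cone of the order-`μ` initial forms is the sum of the ridge ideals of the individual forms, and it
  is generated by its ADDITIVE homogeneous elements (Giraud: `p`-forms `Σ c_i Y_i^{p^e}`);
* REGIME (iv), `E.b < p` (`ridgeIdeal_initialForms_eq_span_linearHasseSet_of_lt_char`,
  `ridgeIdeal_tangentCone_stalk_eq_span_linearHasseSet`, `mem_ridge_tangentCone_stalk_iff`): at every point `ξ` of
  every state `(A, E)` whose local ring has characteristic `p`, the ridge ideal of the tangent cone `V(cl_b(J_ξ))` is
  generated by the LINEAR Hasse–Schmidt coefficients of the initial forms (`linearHasseSet`), so the ridge is a vector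
  subspace of the tangent space and its points over any `κ(ξ)`-algebra form a `κ(ξ)`-linear system — the wild additive
  equations `Σ c_i Y_i^{p^e}`, `e ≥ 1`, of Hironaka's edge datum do not occur; together with p483854 all three cone
  invariants (Dir, `τ`, Rid) are first-order in regime (iv), as in characteristic zero.

## References (context; nothing is cited as a premise)

* this seat's p503312 `RidgeIdealAdditive.lean` (Giraud 1975 §1.5), p504568 `RidgeEqualDegree.lean`, p483854 `TameRegime`.
* J. Giraud, Ann. Sci. ÉNS 8 (1975), §1.5. [cite: Giraud1975, §1.5]
* Cossart–Jannsen–Saito, LNM 2270, Rem. 18.29. [cite: CossartJannsenSaito2020, Remark 18.29]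
-/

noncomputable section

set_option linter.dupNamespace false -- mandated namespace of this single-conjunct summit

open CategoryTheory AlgebraicGeometry TopologicalSpace IsLocalRing

namespace Summit.ResolutionOfSingularities.ResolutionOfSingularities.Theorems
namespace CampaignW46
namespace TameConeRidge

open MvPolynomial
open Literature.AlgebraicGeometry.Resolution
open Literature.AlgebraicGeometry.Hironaka2017.S02Preliminaries
open Literature.AlgebraicGeometry.Hironaka2017.Datum
open Literature.RingTheory.MvPolynomial (isHomogeneousIdeal_span_of_isHomogeneous)

universe u

/-! ## Ring level: the ridge of the cone of the initial forms of an ideal of a local ring -/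

section LocalRing

variable {R : Type u} [CommRing R] [IsLocalRing R] {d : ℕ} (c : Fin d → R)

/-- [OURS · L1 W4.6 (iv); NOT a statement of the manuscript] **Every characteristic: the ridge ideal of the cone
`V(cl_μ(J))` is the sum of the ridge ideals of the individual initial forms** (the initial forms of order `μ` are forms
of one degree `μ`; `RidgeEqualDegree.ridgeIdeal_span_eq_iSup`). [folklore] -/
theorem ridgeIdeal_initialForms_eq_iSup (J : Ideal R) (μ : ℕ) :
    ridgeIdeal (Ideal.span (initialForms c J μ : Set (MvPolynomial (Fin d) (ResidueField R)))) =
      ⨆ G ∈ (initialForms c J μ : Set (MvPolynomial (Fin d) (ResidueField R))), ridgeIdeal (Ideal.span {G}) :=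
  ridgeIdeal_span_eq_iSup fun _ hG => isHomogeneous_of_mem_initialForms c hG

/-- [OURS · L1 W4.6 (iv); NOT a statement of the manuscript] **Every characteristic: the points of the ridge of the cone
`V(cl_μ(J))` over any `κ`-algebra `k'` are the common translation-stabilisers of the initial forms**
(`v ∈ Rid ⟺ G(Y + v) = G(Y)` for every initial form `G` of order `μ`). [folklore] -/
theorem mem_ridge_initialForms_iff (J : Ideal R) (μ : ℕ) {k' : Type*} [CommRing k'] [Algebra (ResidueField R) k']
    (v : Fin d → k') :
    v ∈ ridge k' (Ideal.span (initialForms c J μ : Set (MvPolynomial (Fin d) (ResidueField R)))) ↔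
      ∀ G ∈ (initialForms c J μ : Set (MvPolynomial (Fin d) (ResidueField R))),
        Literature.RingTheory.MvPolynomial.shift v (MvPolynomial.map (algebraMap (ResidueField R) k') G) =
          MvPolynomial.map (algebraMap (ResidueField R) k') G :=
  mem_ridge_span_iff_forall_shift_map_eq fun _ hG => isHomogeneous_of_mem_initialForms c hG

/-- [OURS · L1 W4.6 (iv); NOT a statement of the manuscript] **Every characteristic (Giraud): the ridge ideal of the
cone `V(cl_μ(J))` is generated by its additive homogeneous elements** (`p`-forms `Σ c_i Y_i^{p^e}` in residue
characteristic `p`; `RidgeIdealAdditive.ridgeIdeal_eq_span_isAdditive`, the ideal spanned by forms of one degree being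
homogeneous). [folklore] -/
theorem ridgeIdeal_initialForms_eq_span_isAdditive (J : Ideal R) (μ : ℕ) :
    ridgeIdeal (Ideal.span (initialForms c J μ : Set (MvPolynomial (Fin d) (ResidueField R)))) =
      Ideal.span {θ | θ ∈ ridgeIdeal (Ideal.span (initialForms c J μ : Set (MvPolynomial (Fin d) (ResidueField R)))) ∧
        IsAdditive θ ∧ ∃ q : ℕ, θ.IsHomogeneous q} :=
  ridgeIdeal_eq_span_isAdditive
    (isHomogeneousIdeal_span_of_isHomogeneous fun _ hG => ⟨μ, isHomogeneous_of_mem_initialForms c hG⟩)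

/-- [OURS · L1 W4.6 (iv); NOT a statement of the manuscript] **Tame order: the ridge ideal of the cone `V(cl_μ(J))` is
generated by the LINEAR Hasse–Schmidt coefficients of the initial forms** whenever `1, …, μ` are non-zero in the residue
field (`RidgeEqualDegree.ridgeIdeal_span_eq_span_linearHasseSet`): the ridge is a vector subspace. [folklore] -/
theorem ridgeIdeal_initialForms_eq_span_linearHasseSet (J : Ideal R) {μ : ℕ}
    (hchar : ∀ m : ℕ, 1 ≤ m → m ≤ μ → (m : ResidueField R) ≠ 0) :
    ridgeIdeal (Ideal.span (initialForms c J μ : Set (MvPolynomial (Fin d) (ResidueField R)))) =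
      Ideal.span (linearHasseSet (initialForms c J μ : Set (MvPolynomial (Fin d) (ResidueField R))) μ) :=
  ridgeIdeal_span_eq_span_linearHasseSet (fun _ hG => isHomogeneous_of_mem_initialForms c hG) hchar

/-- [OURS · L1 W4.6 (iv)] The same in residue characteristic `p > μ` (the local ring itself of characteristic `p`).
[folklore] -/
theorem ridgeIdeal_initialForms_eq_span_linearHasseSet_of_lt_char (p : ℕ) [Fact p.Prime] [CharP R p] (J : Ideal R)
    {μ : ℕ} (hμ : μ < p) :
    ridgeIdeal (Ideal.span (initialForms c J μ : Set (MvPolynomial (Fin d) (ResidueField R)))) =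
      Ideal.span (linearHasseSet (initialForms c J μ : Set (MvPolynomial (Fin d) (ResidueField R))) μ) :=
  haveI := TameRegime.charP_residueField (R := R) p
  ridgeIdeal_initialForms_eq_span_linearHasseSet c J (TamePolar.natCast_ne_zero_of_lt_char p hμ)

/-- [OURS · L1 W4.6 (iv); NOT a statement of the manuscript] **Tame order: the generators are linear forms.** [folklore] -/
theorem isHomogeneous_one_of_mem_linearHasseSet_initialForms (J : Ideal R) (μ : ℕ)
    {l : MvPolynomial (Fin d) (ResidueField R)}
    (hl : l ∈ linearHasseSet (initialForms c J μ : Set (MvPolynomial (Fin d) (ResidueField R))) μ) :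
    l.IsHomogeneous 1 :=
  isHomogeneous_one_of_mem_linearHasseSet (fun _ hG => isHomogeneous_of_mem_initialForms c hG) hl

end LocalRing

/-! ## Typed level: regime (iv) of the shared module, `E.b < p` -/

section Typed

variable {n : ℕ} {p : ℕ} [Fact p.Prime] {K : Type u} [Field K] [CharP K p]

/-- [OURS · L1 W4.6 (iv); NOT a statement of the manuscript] **Regime (iv) makes the ridge of the tangent cone linear at
every point of every state.** For a state `(A, E)` of the typed procedure in `Regime.charGT n (fun _ b ↦ b)`
(`E.b < p`), a point `ξ` of `Z` whose local ring has characteristic `p` (the typed rows' standing binder) and elements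
`c_1, …, c_d ∈ 𝒪_{Z,ξ}`: the ridge ideal of the cone `V(cl_b(J_ξ))` of the order-`b` initial forms of the stalk ideal
`J_ξ = stalkIdeal E.J ξ` is generated by the linear Hasse–Schmidt coefficients of the initial forms. [folklore] -/
theorem ridgeIdeal_tangentCone_stalk_eq_span_linearHasseSet (A : AmbientDatum p K) (E : IdealExponent A.Z)
    (hE : Regime.charGT (p := p) (K := K) n (fun _ b => b) A E) (ξ : A.Z) (hp : CharP (A.Z.presheaf.stalk ξ) p)
    {d : ℕ} (c : Fin d → A.Z.presheaf.stalk ξ) :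
    ridgeIdeal (Ideal.span (initialForms c (stalkIdeal E.J ξ) E.b :
        Set (MvPolynomial (Fin d) (ResidueField (A.Z.presheaf.stalk ξ))))) =
      Ideal.span (linearHasseSet (initialForms c (stalkIdeal E.J ξ) E.b :
        Set (MvPolynomial (Fin d) (ResidueField (A.Z.presheaf.stalk ξ)))) E.b) :=
  haveI := hp
  ridgeIdeal_initialForms_eq_span_linearHasseSet_of_lt_char c p (stalkIdeal E.J ξ) hE

/-- [OURS · L1 W4.6 (iv); NOT a statement of the manuscript] **Regime (iv): the points of the ridge of the tangent cone
form a `κ(ξ)`-linear system** — over every commutative `κ(ξ)`-algebra `k'` (universe of `κ(ξ)`), `v ∈ Rid(k')` iff every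
linear Hasse–Schmidt coefficient of the order-`b` initial forms vanishes at `v`. [folklore] -/
theorem mem_ridge_tangentCone_stalk_iff (A : AmbientDatum p K) (E : IdealExponent A.Z)
    (hE : Regime.charGT (p := p) (K := K) n (fun _ b => b) A E) (ξ : A.Z) (hp : CharP (A.Z.presheaf.stalk ξ) p)
    {d : ℕ} (c : Fin d → A.Z.presheaf.stalk ξ) {k' : Type u} [CommRing k']
    [Algebra (ResidueField (A.Z.presheaf.stalk ξ)) k'] (v : Fin d → k') :
    v ∈ ridge k' (Ideal.span (initialForms c (stalkIdeal E.J ξ) E.b :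
        Set (MvPolynomial (Fin d) (ResidueField (A.Z.presheaf.stalk ξ))))) ↔
      ∀ l ∈ linearHasseSet (initialForms c (stalkIdeal E.J ξ) E.b :
          Set (MvPolynomial (Fin d) (ResidueField (A.Z.presheaf.stalk ξ)))) E.b, aeval v l = 0 := by
  haveI := hp
  haveI := TameRegime.charP_residueField (R := A.Z.presheaf.stalk ξ) p
  exact mem_ridge_span_iff_forall_linearHasseSet (fun _ hG => isHomogeneous_of_mem_initialForms c hG)
    (TamePolar.natCast_ne_zero_of_lt_char p hE) v

/-- [OURS · L1 W4.6 (iv); NOT a statement of the manuscript] **Every regime, every point: the ridge ideal of the tangent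
cone is generated by additive homogeneous `p`-forms** (Giraud's structure theorem read at a typed state; in regime (iv)
these forms are linear by `ridgeIdeal_tangentCone_stalk_eq_span_linearHasseSet`). [folklore] -/
theorem ridgeIdeal_tangentCone_stalk_eq_span_isAdditive (A : AmbientDatum p K) (E : IdealExponent A.Z) (ξ : A.Z)
    {d : ℕ} (c : Fin d → A.Z.presheaf.stalk ξ) :
    ridgeIdeal (Ideal.span (initialForms c (stalkIdeal E.J ξ) E.b :
        Set (MvPolynomial (Fin d) (ResidueField (A.Z.presheaf.stalk ξ))))) =
      Ideal.span {θ | θ ∈ ridgeIdeal (Ideal.span (initialForms c (stalkIdeal E.J ξ) E.b :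
          Set (MvPolynomial (Fin d) (ResidueField (A.Z.presheaf.stalk ξ))))) ∧ IsAdditive θ ∧
        ∃ q : ℕ, θ.IsHomogeneous q} :=
  ridgeIdeal_initialForms_eq_span_isAdditive c (stalkIdeal E.J ξ) E.b

/-- [OURS · L1 W4.6 (iv)] Monotonicity in the threshold (p471737 `Regime.charGT_of_le`): the linear description of the
ridge holds in every regime `Regime.charGT n f` with `(fun _ b ↦ b) ≤ f` (e.g. V5's `fun _ b ↦ b !`). [folklore] -/
theorem ridgeIdeal_tangentCone_stalk_of_le {f : ℕ → ℕ → ℕ} (hf : (fun _ b : ℕ => b) ≤ f)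
    (A : AmbientDatum p K) (E : IdealExponent A.Z) (hE : Regime.charGT (p := p) (K := K) n f A E) (ξ : A.Z)
    (hp : CharP (A.Z.presheaf.stalk ξ) p) {d : ℕ} (c : Fin d → A.Z.presheaf.stalk ξ) :
    ridgeIdeal (Ideal.span (initialForms c (stalkIdeal E.J ξ) E.b :
        Set (MvPolynomial (Fin d) (ResidueField (A.Z.presheaf.stalk ξ))))) =
      Ideal.span (linearHasseSet (initialForms c (stalkIdeal E.J ξ) E.b :
        Set (MvPolynomial (Fin d) (ResidueField (A.Z.presheaf.stalk ξ)))) E.b) :=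
  ridgeIdeal_tangentCone_stalk_eq_span_linearHasseSet A E (Regime.charGT_of_le (fun b => hf n b) A E hE) ξ hp c

end Typed

end TameConeRidge
end CampaignW46
end Summit.ResolutionOfSingularities.ResolutionOfSingularities.Theorems

end
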